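import Literature.Analysis.FluidPDE.PassiveVectorTensorPropagatorBandKill
import Literature.Analysis.FluidPDE.PassiveVectorTensorPropagatorEnergy
import Literature.Analysis.FluidPDE.PassiveVectorTensorSymmetry
import HarnessLib

/-!
# OFF-BALL ENERGY DECAY of weak tensor passive-vector solutions and of the window propagator on Bloch sectors:
# `‖w(t)‖² ≤ e^{−8π²·lo·N₀²·t}‖w₀‖²` when the Fourier support stays off the ball `|k| ≤ N₀`

Analysis/FluidPDE proof file (everything proved; no definitions, no named facts).  Setting of `PassiveVectorTensorEnergyDecay`:
the weak class `Torus.IsWeakTensorPassiveVectorOn 0 T 𝔸 b w₀ w` (`∂ₜw + (b·∇)w + ∇π = 𝓛_𝔸 w`, `∇·w = 0`) with a constant tensor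
`NearIso 𝔸 lo hi`, `0 < lo`, a carrier `b ∈ L^∞((0,T) × T^d)` and an `L²` divergence-free datum.
* §1 `ae_sq_mul_sum_sq_norm_le_symbForm_of_off_ball` — if `ŵ(s)` vanishes on `freqBall N₀`, the truncated symbol form dominates
  `4π²·lo·N₀²·Σ_{|k|≤N}‖ŵ(s)(k)‖²` (coercivity `lo|k|²‖z‖² ≤ Re⟪z, T_𝔸(k)z⟫` on transversal `z`, `|k|² > N₀²` off the ball);
* §2 `ae_integral_norm_sq_le_exp_of_off_ball` — **if for a.e. `s` the Fourier coefficients of `w(s)` vanish on `freqBall N₀`, then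
  for a.e. `t`, `‖w(t)‖² ≤ exp(−8π²·lo·N₀²·t)·‖w₀‖²**: the proof of `ae_integral_norm_sq_le_exp` (mean-zero data, Poincaré constant `4π²`)
  VERBATIM with the Poincaré constant `4π²N₀²` of the off-ball support (energy equality with the tensor dissipation, continuous
  representative `E(t) = ‖w₀‖² − 2∫₀ᵗ Q`, two-point inequality `E(t₂)(1 + c(t₂ − t₁)) ≤ E(t₁)`, partition-and-limit);
* §3 `IsPropagator.norm_sq_apply_le_exp_of_multiplier` — **sector decay of the window propagator**: if the carrier is invariant under
  finitely many translations `gᵢ` and the real multiplier `ĉ(k) = Σᵢ cᵢ e_k(gᵢ)` takes ONE nonzero value `m` on the Fourier support of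
  `y ∈ L²` and values `≠ m` on the whole ball `freqBall N₀`, then `‖U s t y‖² ≤ exp(−8π²·lo·N₀²·(t − s))·‖y‖²` for ALL `0 ≤ s ≤ t ≤ T`
  (the Leray projection is modewise, so `P_σ y` has the same support; the chosen window solution from `P_σ y` keeps its support in the
  level set `{ĉ = m}` for a.e. time by `IsWeakTensorPassiveVectorOn.ae_mFourierCoeff_eq_zero_of_multiplier'` (Bloch-sector confinement
  along a periodic carrier), hence off the ball; §2 gives the a.e. decay; `IsPropagator.repr` identifies the window solution with
  `U s (s+τ) y` for a.e. `τ`, and the every-time statement follows from the monotonicity `‖U s t y‖ ≤ ‖U s t′ y‖` (`t′ ≤ t`) and the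
  density of the good times below `t`).
Consumer: cell `ad-ideate`, K1L_D `stmt-AnomalousDissipation-27980`, the (ℓ2) flat blocks of `stub_Vmod_of_VR(H)`: along the
`(1/n)`-periodic cell field the Bloch classes `ℓ + nℤ^d` are preserved, and data carried by classes WITHOUT a slow member (every member
off `freqBall (n/4)`) are damped by the window propagator at the molecular rate of the ball's edge — the input-free part of the (ff) block
(finding F-k3l9-1); also the «bare decay of off-line content» of W7 `HighLabelDecayW` and tool T-M of the certifier's regime table.

## Mathlib / tree search
Tree: `PassiveVectorTensorEnergyDecay` (`ae_integral_norm_sq_le_exp` — the template; its helpers `ae_tendsto_setIntegral_symbForm`,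
`ae_energy_ineq`, `integrableOn_integral_norm_sq`), `PassiveVectorTensorGalerkinIdentity` (`ae_sum_mul_mFourierCoeff_eq_zero`,
`ae_re_inner_symbT_nonneg`, `ae_symbForm_mono`, `integrableOn_symbForm`), `PassiveVectorTensorUniqueness.lo_mul_le_re_inner_symbT`,
`PassiveVectorTensorCubeDescentDecay.le_mul_exp_neg_of_two_point_ineq`, `PassiveVectorTensorSymmetry.ae_mFourierCoeff_eq_zero_of_multiplier'`,
`PassiveVectorTensorPropagator` (`windowSol`, `IsPropagator.repr`), `PassiveVectorTensorPropagatorUnique.apply_eq_apply_starProjection`,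
`PassiveVectorTensorPropagatorEnergy.norm_apply_le_of_le`, `PassiveVectorTensorPropagatorBandKill` (`norm_sq_eq_integral_norm_sq`,
`memLp_top_stLift_shift_window`), `DivFreeProjectionFourier.norm_mFourierCoeff_starProjection_le`, `TorusTrigPoly.not_mem_freqBall`.
No off-ball / sector decay statement for the weak class or the propagator existed (2026-08-29).

## References
* R. Temam, *Navier–Stokes Equations*, 3rd ed. (North-Holland 1984), Ch. III §1, Lemma 1.2 (energy inequality). [`Temam1984`]
* M. Giaquinta, *Multiple integrals in the calculus of variations and nonlinear elliptic systems* (Princeton 1983), Ch. III §2 (2.2)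
  (Legendre–Hadamard coercivity on rank-one directions). [`Giaquinta1983MultipleIntegrals`]
* M. Kha, P. Kuchment, arXiv:2007.02832 (2021), §1.1–§1.2 (periodic operators commute with the lattice action; Bloch sectors).
  [`KhaKuchment2021`]
* A. Pazy, *Semigroups of Linear Operators and Applications to PDE* (Springer 1983), Ch. 5 §5.1 Def. 5.3 (evolution systems).
  [`Pazy1983`]
-/

noncomputable section

open MeasureTheory Set Filter Function TopologicalSpace Complex UnitAddTorus
open scoped ENNReal NNReal InnerProductSpace Topology ComplexConjugate

namespace Literature.Analysis.FluidPDE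

namespace Torus

variable {d : Type*} [Fintype d] [DecidableEq d]

namespace IsWeakTensorPassiveVectorOn

variable {A T : ℝ} {𝔸 : Visc4 d} {b w : ℝ → UnitAddTorus d → EuclideanSpace ℝ d} {w₀ : UnitAddTorus d → EuclideanSpace ℝ d}

/-! ## §1 Coercivity of the truncated symbol form off a Fourier ball -/

/-- **Coercivity of the truncated symbol form against the truncated energy, off the ball `freqBall N₀`**: if `ŵ(s)(k) = 0` for
`|k|² ≤ N₀²`, then `4π²·lo·N₀²·Σ_{|k|≤N} ‖ŵ(s)(k)‖² ≤ Q_N(s)` for every `N` (`|k|² > N₀²` off the ball, `lo|k|²‖z‖² ≤ Re⟪z, T_𝔸(k)z⟫`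
on the transversal coefficients). [cite: Giaquinta1983MultipleIntegrals, Ch. III §2 eq. (2.2)] -/
theorem ae_sq_mul_sum_sq_norm_le_symbForm_of_off_ball (h : IsWeakTensorPassiveVectorOn A T 𝔸 b w₀ w) {lo hi : ℝ}
    (h𝔸 : NearIso 𝔸 lo hi) (hlo : 0 ≤ lo) (N₀ : ℕ) :
    ∀ᵐ s ∂(volume.restrict (Ioo 0 T)), (∀ k ∈ FunctionSpaces.Torus.freqBall (d := d) N₀,
        mFourierCoeff (FunctionSpaces.EuclideanSpace.complexify ∘ w s) k = 0) →
      ∀ N : ℕ, 4 * Real.pi ^ 2 * lo * (N₀ : ℝ) ^ 2 *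
          ∑ k ∈ FunctionSpaces.Torus.freqBall N, ‖mFourierCoeff (FunctionSpaces.EuclideanSpace.complexify ∘ w s) k‖ ^ 2 ≤
        4 * Real.pi ^ 2 * ∑ k ∈ FunctionSpaces.Torus.freqBall N,
          (⟪mFourierCoeff (FunctionSpaces.EuclideanSpace.complexify ∘ w s) k,
            symbT 𝔸 k (mFourierCoeff (FunctionSpaces.EuclideanSpace.complexify ∘ w s) k)⟫_ℂ).re := by
  have htr := ae_all_iff.2 fun k => h.ae_sum_mul_mFourierCoeff_eq_zero k
  filter_upwards [htr] with s hs
  intro h0 N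
  have e : 4 * Real.pi ^ 2 * lo * (N₀ : ℝ) ^ 2 *
      ∑ k ∈ FunctionSpaces.Torus.freqBall N, ‖mFourierCoeff (FunctionSpaces.EuclideanSpace.complexify ∘ w s) k‖ ^ 2 =
      4 * Real.pi ^ 2 * ∑ k ∈ FunctionSpaces.Torus.freqBall N,
        lo * (N₀ : ℝ) ^ 2 * ‖mFourierCoeff (FunctionSpaces.EuclideanSpace.complexify ∘ w s) k‖ ^ 2 := by
    rw [Finset.mul_sum, Finset.mul_sum]
    exact Finset.sum_congr rfl fun k _ => by ring
  rw [e]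
  refine mul_le_mul_of_nonneg_left (Finset.sum_le_sum fun k _ => ?_) (by positivity)
  by_cases hk : k ∈ FunctionSpaces.Torus.freqBall (d := d) N₀
  · rw [h0 k hk]
    simp
  · have h1 : ((N₀ : ℝ)) ^ 2 < FunctionSpaces.Torus.freqNormSq k := FunctionSpaces.Torus.not_mem_freqBall.1 hk
    have hco := lo_mul_le_re_inner_symbT h𝔸 (hs k)
    have hz : 0 ≤ ‖mFourierCoeff (FunctionSpaces.EuclideanSpace.complexify ∘ w s) k‖ ^ 2 := sq_nonneg _
    nlinarith [hco, h1, hz, mul_nonneg hlo hz]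

/-! ## §2 Exponential decay off a Fourier ball -/

/-- **Exponential energy decay for solutions supported off a Fourier ball.**  For `A = 0`, `NearIso 𝔸 lo hi` with `0 < lo`,
`stLift b ∈ L^∞((0,T) × T^d)`, an `L²` weakly divergence-free datum `w₀`, and a weak solution `w` whose Fourier coefficients vanish on
`freqBall N₀` for a.e. time: for a.e. `t ∈ (0,T)`, `‖w(t)‖²_{L²} ≤ exp(−8π²·lo·N₀²·t)·‖w₀‖²_{L²}`.  (Proof = `ae_integral_norm_sq_le_exp`
with the off-ball Poincaré constant `4π²N₀²`: energy equality with the tensor dissipation, continuous representative of the energy,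
two-point inequality, partition-and-limit.) [cite: Temam1984, Ch. III §1 Lemma 1.2] [cite: Giaquinta1983MultipleIntegrals, Ch. III §2 eq. (2.2)] -/
theorem ae_integral_norm_sq_le_exp_of_off_ball (h : IsWeakTensorPassiveVectorOn 0 T 𝔸 b w₀ w)
    {lo hi : ℝ} (h𝔸 : NearIso 𝔸 lo hi) (hlo : 0 < lo)
    (hw₀ : MemLp w₀ 2 volume) (hdiv₀ : FunctionSpaces.Torus.IsWeaklyDivFree w₀)
    (hb : MemLp (FunctionSpaces.Torus.stLift b) ∞ (volume.restrict (Ioo 0 T ×ˢ univ))) (N₀ : ℕ)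
    (hoff : ∀ᵐ s ∂(volume.restrict (Ioo 0 T)), ∀ k ∈ FunctionSpaces.Torus.freqBall (d := d) N₀,
      mFourierCoeff (FunctionSpaces.EuclideanSpace.complexify ∘ w s) k = 0) :
    ∀ᵐ t ∂(volume.restrict (Ioo 0 T)),
      ∫ x, ‖w t x‖ ^ 2 ≤ Real.exp (-(8 * Real.pi ^ 2 * lo * (N₀ : ℝ) ^ 2 * t)) * ∫ x, ‖w₀ x‖ ^ 2 := by
  classical
  -- ### notation
  set X : (d → ℤ) → ℝ → EuclideanSpace ℂ d := fun k s =>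
    mFourierCoeff (FunctionSpaces.EuclideanSpace.complexify ∘ w s) k with hX
  set Q : ℕ → ℝ → ℝ := fun N s => 4 * Real.pi ^ 2 * ∑ k ∈ FunctionSpaces.Torus.freqBall N,
    (⟪X k s, symbT 𝔸 k (X k s)⟫_ℂ).re with hQ
  set E : ℝ → ℝ := fun s => ∫ x, ‖w s x‖ ^ 2 with hE
  set E₀ : ℝ := ∫ x, ‖w₀ x‖ ^ 2 with hE₀
  set c : ℝ := 8 * Real.pi ^ 2 * lo * (N₀ : ℝ) ^ 2 with hc
  have hc0 : 0 ≤ c := by positivity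
  -- the supremum of the truncated symbol forms, in `ℝ≥0∞`
  set Qs : ℝ → ℝ≥0∞ := fun s => ⨆ N : ℕ, ENNReal.ofReal (Q N s) with hQs
  -- ### a.e.-in-`s` facts
  have hQint : ∀ N, IntegrableOn (Q N) (Ioo 0 T) := fun N => h.integrableOn_symbForm N
  have hmono : ∀ᵐ s ∂(volume.restrict (Ioo 0 T)), Monotone fun N : ℕ => Q N s := h.ae_symbForm_mono h𝔸 hlo.le
  have hQnn : ∀ᵐ s ∂(volume.restrict (Ioo 0 T)), ∀ N, 0 ≤ Q N s := by
    filter_upwards [h.ae_re_inner_symbT_nonneg h𝔸 hlo.le] with s hs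
    intro N
    exact mul_nonneg (by positivity) (Finset.sum_nonneg fun k _ => hs k)
  -- the energy lower bound of the symbol form off the ball: `4π² lo N₀² E_N(s) ≤ Q_N(s)`, hence `ofReal (c/2 · E(s)) ≤ Qs s`
  have hlow : ∀ᵐ s ∂(volume.restrict (Ioo 0 T)), ENNReal.ofReal (c / 2 * E s) ≤ Qs s := by
    filter_upwards [h.ae_sq_mul_sum_sq_norm_le_symbForm_of_off_ball h𝔸 hlo.le N₀, hoff, h.ae_memLp_two] with s hs hz hs2
    have hEN : Tendsto (fun N => c / 2 * ∑ k ∈ FunctionSpaces.Torus.freqBall N, ‖X k s‖ ^ 2) atTop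
        (𝓝 (c / 2 * E s)) :=
      ((FunctionSpaces.Torus.hasSum_sq_norm_mFourierCoeff_complexify hs2).comp
        FunctionSpaces.Torus.tendsto_freqBall_atTop).const_mul _
    have hEN' := ENNReal.tendsto_ofReal hEN
    refine le_of_tendsto' hEN' fun N => ?_
    have h1 : c / 2 * ∑ k ∈ FunctionSpaces.Torus.freqBall N, ‖X k s‖ ^ 2 ≤ Q N s := by
      have := hs hz N
      rw [hc, hQ]
      simp only
      linarith
    exact (ENNReal.ofReal_le_ofReal h1).trans (le_iSup (fun N : ℕ => ENNReal.ofReal (Q N s)) N)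
  -- measurability of `Qs`
  have hQm : ∀ N, AEMeasurable (fun s => ENNReal.ofReal (Q N s)) (volume.restrict (Ioo 0 T)) := fun N =>
    (hQint N).aestronglyMeasurable.aemeasurable.ennreal_ofReal
  -- ### the energy identity with `Qs`, at a.e. `t`: `2 (∫⁻_{(0,t]} Qs).toReal = E₀ - E t`
  have hEq : ∀ᵐ t ∂(volume.restrict (Ioo 0 T)), ∫⁻ s in Ioc 0 t, Qs s = ENNReal.ofReal ((E₀ - E t) / 2) := by
    filter_upwards [h.ae_tendsto_setIntegral_symbForm h𝔸 hlo hw₀ hdiv₀ hb, ae_restrict_mem measurableSet_Ioo] with t ht htI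
    have hsub : Ioc 0 t ⊆ Ioo 0 T := Ioc_subset_Ioo_right htI.2
    -- monotone convergence on `(0,t]`
    have hmc : ∫⁻ s in Ioc 0 t, Qs s = ⨆ N : ℕ, ∫⁻ s in Ioc 0 t, ENNReal.ofReal (Q N s) := by
      rw [hQs]
      exact lintegral_iSup' (fun N => (hQm N).mono_measure (Measure.restrict_mono hsub le_rfl))
        (ae_restrict_of_ae_restrict_of_subset hsub (hmono.mono fun s hs N N' hNN' => ENNReal.ofReal_le_ofReal (hs hNN')))
    have heq : ∀ N, ∫⁻ s in Ioc 0 t, ENNReal.ofReal (Q N s) = ENNReal.ofReal (∫ s in Ioc 0 t, Q N s) := fun N =>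
      (ofReal_integral_eq_lintegral_ofReal ((hQint N).mono_set hsub)
        (ae_restrict_of_ae_restrict_of_subset hsub (hQnn.mono fun s hs => hs N))).symm
    simp_rw [heq] at hmc
    rw [hmc]
    -- the `ofReal` of a convergent monotone sequence
    have hmono' : Monotone fun N : ℕ => ENNReal.ofReal (∫ s in Ioc 0 t, Q N s) := by
      intro N N' hNN'
      refine ENNReal.ofReal_le_ofReal (integral_mono_ae ((hQint N).mono_set hsub) ((hQint N').mono_set hsub) ?_)
      exact ae_restrict_of_ae_restrict_of_subset hsub (hmono.mono fun s hs => hs hNN')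
    have h1 : Tendsto (fun N : ℕ => ENNReal.ofReal (∫ s in Ioc 0 t, Q N s)) atTop
        (𝓝 (⨆ N : ℕ, ENNReal.ofReal (∫ s in Ioc 0 t, Q N s))) := tendsto_atTop_iSup hmono'
    have h2 := ENNReal.tendsto_ofReal ht
    exact tendsto_nhds_unique h1 h2
  have hEq' : ∀ᵐ t ∂(volume : Measure ℝ), t ∈ Ioo 0 T → ∫⁻ s in Ioc 0 t, Qs s = ENNReal.ofReal ((E₀ - E t) / 2) :=
    (ae_restrict_iff' measurableSet_Ioo).1 hEq
  have hlow' : ∀ᵐ s ∂(volume : Measure ℝ), s ∈ Ioo 0 T → ENNReal.ofReal (c / 2 * E s) ≤ Qs s :=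
    (ae_restrict_iff' measurableSet_Ioo).1 hlow
  -- ### the energy is below the initial energy, and the representative agrees with it, a.e.
  have hEle' : ∀ᵐ s ∂(volume : Measure ℝ), s ∈ Ioo 0 T → E s ≤ E₀ := by
    refine (ae_restrict_iff' measurableSet_Ioo).1 ?_
    filter_upwards [h.ae_energy_ineq h𝔸 hlo hw₀ hdiv₀ hb] with s hs
    have h1 : ENNReal.ofReal (E s) ≤ ENNReal.ofReal E₀ := le_trans le_self_add hs
    exact (ENNReal.ofReal_le_ofReal_iff (integral_nonneg fun x => sq_nonneg _)).1 h1
  -- ### the continuous representative of the energy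
  set Et : ℝ → ℝ := fun t => E₀ - 2 * (∫⁻ s in Ioc 0 t, Qs s).toReal with hEt
  have hEint : IntegrableOn E (Ioo 0 T) := h.integrableOn_integral_norm_sq
  have hrep : ∀ᵐ s ∂(volume : Measure ℝ), s ∈ Ioo 0 T → Et s = E s := by
    filter_upwards [hEq', hEle'] with s hs hs' hsI
    rw [hEt]
    simp only
    rw [hs hsI, ENNReal.toReal_ofReal (by linarith [hs' hsI])]
    ring
  -- ### conclude at a.e. `t`
  filter_upwards [hEq, (ae_restrict_iff' measurableSet_Ioo).2 hrep, ae_restrict_mem measurableSet_Ioo] with t ht hrept htI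
  have hEt_t : Et t = E t := hrept
  -- finiteness of the partial integrals up to `t`
  have hIt : ∫⁻ s in Ioc 0 t, Qs s ≠ ⊤ := by rw [ht]; exact ENNReal.ofReal_ne_top
  have hIfin : ∀ s, s ≤ t → ∫⁻ r in Ioc 0 s, Qs r ≠ ⊤ := fun s hs =>
    ne_top_of_le_ne_top hIt (lintegral_mono_set (Ioc_subset_Ioc_right hs))
  -- `Et` is nonincreasing on `[0, t]`
  have hanti : AntitoneOn Et (Icc 0 t) := by
    intro s₁ hs₁ s₂ hs₂ h12
    simp only [hEt]
    have hmono : ∫⁻ r in Ioc 0 s₁, Qs r ≤ ∫⁻ r in Ioc 0 s₂, Qs r := lintegral_mono_set (Ioc_subset_Ioc_right h12)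
    have := ENNReal.toReal_mono (hIfin s₂ hs₂.2) hmono
    linarith
  -- the two-point inequality
  have htwo : ∀ s₁ s₂, 0 ≤ s₁ → s₁ ≤ s₂ → s₂ ≤ t → Et s₂ * (1 + c * (s₂ - s₁)) ≤ Et s₁ := by
    intro s₁ s₂ h0 h12 h2t
    have hsubI : Ioc s₁ s₂ ⊆ Ioo 0 T := fun r hr => ⟨h0.trans_lt hr.1, hr.2.trans_lt (h2t.trans_lt htI.2)⟩
    -- split the partial integral
    have hsplit : ∫⁻ r in Ioc 0 s₂, Qs r = (∫⁻ r in Ioc 0 s₁, Qs r) + ∫⁻ r in Ioc s₁ s₂, Qs r := by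
      rw [← lintegral_union measurableSet_Ioc (Ioc_disjoint_Ioc_of_le le_rfl), Ioc_union_Ioc_eq_Ioc h0 h12]
    have hfin2 := hIfin s₂ h2t
    have hfin12 : ∫⁻ r in Ioc s₁ s₂, Qs r ≠ ⊤ :=
      ne_top_of_le_ne_top hfin2 (by rw [hsplit]; exact le_add_self)
    have hdiff : Et s₁ - Et s₂ = 2 * (∫⁻ r in Ioc s₁ s₂, Qs r).toReal := by
      simp only [hEt]
      rw [hsplit, ENNReal.toReal_add (hIfin s₁ (h12.trans h2t)) hfin12]
      ring
    -- lower bound of the middle integral by the energy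
    have hEI : IntegrableOn (fun r => c / 2 * E r) (Ioc s₁ s₂) := (hEint.mono_set hsubI).const_mul _
    have hlowI : ENNReal.ofReal (∫ r in Ioc s₁ s₂, c / 2 * E r) ≤ ∫⁻ r in Ioc s₁ s₂, Qs r := by
      rw [ofReal_integral_eq_lintegral_ofReal hEI
        (ae_of_all _ fun r => mul_nonneg (by positivity) (integral_nonneg fun x => sq_nonneg _))]
      refine lintegral_mono_ae ((ae_restrict_iff' measurableSet_Ioc).2 (hlow'.mono fun r hr hrI => hr (hsubI hrI)))
    have hlowR : ∫ r in Ioc s₁ s₂, c / 2 * E r ≤ (∫⁻ r in Ioc s₁ s₂, Qs r).toReal := by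
      have := ENNReal.toReal_mono hfin12 hlowI
      rwa [ENNReal.toReal_ofReal (setIntegral_nonneg measurableSet_Ioc fun r _ =>
        mul_nonneg (by positivity) (integral_nonneg fun x => sq_nonneg _))] at this
    -- replace `E` by `Et` inside the integral and use monotonicity
    have hEtI : IntegrableOn Et (Ioc s₁ s₂) :=
      ((hanti.mono (Icc_subset_Icc h0 h2t)).integrableOn_isCompact isCompact_Icc).mono_set Ioc_subset_Icc_self
    have hrepI : ∫ r in Ioc s₁ s₂, c / 2 * E r = ∫ r in Ioc s₁ s₂, c / 2 * Et r := by
      refine setIntegral_congr_ae measurableSet_Ioc ?_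
      filter_upwards [hrep] with r hr hrI
      rw [hr (hsubI hrI)]
    have hmonoI : ∫ r in Ioc s₁ s₂, c / 2 * Et s₂ ≤ ∫ r in Ioc s₁ s₂, c / 2 * Et r := by
      refine setIntegral_mono_on (integrableOn_const (by rw [Real.volume_Ioc]; exact ENNReal.ofReal_ne_top))
        (hEtI.const_mul _) measurableSet_Ioc fun r hr => ?_
      exact mul_le_mul_of_nonneg_left
        (hanti ⟨h0.trans hr.1.le, hr.2.trans h2t⟩ ⟨h0.trans h12, h2t⟩ hr.2) (by positivity)
    have hconst : ∫ r in Ioc s₁ s₂, c / 2 * Et s₂ = (s₂ - s₁) * (c / 2 * Et s₂) := by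
      rw [setIntegral_const, smul_eq_mul, measureReal_def, Real.volume_Ioc, ENNReal.toReal_ofReal (by linarith)]
    -- assemble
    have key : (s₂ - s₁) * (c / 2 * Et s₂) ≤ (Et s₁ - Et s₂) / 2 := by
      rw [hdiff]
      linarith [hmonoI, hlowR, hrepI, hconst]
    nlinarith [key]
  -- the decay of the representative
  have hdec := le_mul_exp_neg_of_two_point_ineq (g := Et) hc0 htI.1.le htwo
  have hEt0 : Et 0 = E₀ := by
    simp only [hEt]
    rw [Ioc_self, Measure.restrict_empty, lintegral_zero_measure, ENNReal.toReal_zero, mul_zero, sub_zero]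
  rw [hEt_t, hEt0] at hdec
  calc E t ≤ E₀ * Real.exp (-(c * t)) := hdec
    _ = Real.exp (-(8 * Real.pi ^ 2 * lo * (N₀ : ℝ) ^ 2 * t)) * E₀ := by rw [hc, mul_comm]

end IsWeakTensorPassiveVectorOn

/-! ## §3 Sector decay of the window propagator -/

namespace IsPropagator

variable {T : ℝ} {𝔸 : Visc4 d} {lo hi : ℝ} {b : ℝ → UnitAddTorus d → EuclideanSpace ℝ d}
variable {U : ℝ → ℝ → (Lp (EuclideanSpace ℝ d) 2 (volume : Measure (UnitAddTorus d)) →L[ℝ]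
  Lp (EuclideanSpace ℝ d) 2 (volume : Measure (UnitAddTorus d)))}

/-- **SECTOR DECAY OF THE WINDOW PROPAGATOR.**  Let `U` be an `IsPropagator T b 𝔸 U` family with `NearIso 𝔸 lo hi`, `0 < lo`, an
essentially bounded, a.e. weakly divergence-free carrier invariant under finitely many translations `gᵢ` of the torus, and real weights
`cᵢ` whose multiplier `ĉ(k) = Σᵢ cᵢ e_k(gᵢ)` equals ONE nonzero real value `m` on the Fourier support of `y ∈ L²` and differs from `m`
on the ball `freqBall N₀`.  Then for all `0 ≤ s ≤ t ≤ T`: `‖U s t y‖² ≤ exp(−8π²·lo·N₀²·(t − s))·‖y‖²`.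
[cite: Temam1984, Ch. III §1 Lemma 1.2] [cite: KhaKuchment2021, §1.1–§1.2] [cite: Pazy1983, Ch. 5 §5.1 Def. 5.3] -/
theorem norm_sq_apply_le_exp_of_multiplier (hU : IsPropagator T b 𝔸 U) (h𝔸 : NearIso 𝔸 lo hi) (hlo : 0 < lo)
    (hb : MemLp (FunctionSpaces.Torus.stLift b) ∞ (volume.restrict (Ioo 0 T ×ˢ univ)))
    (hbdiv : ∀ᵐ τ ∂(volume.restrict (Ioo 0 T)), FunctionSpaces.Torus.IsWeaklyDivFree (b τ))
    {ι : Type*} [Fintype ι] [Nonempty ι] (g : ι → UnitAddTorus d) (c : ι → ℝ)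
    (hper : ∀ i t x, b t (x + g i) = b t x) {m : ℝ} (hm : m ≠ 0) (N₀ : ℕ)
    (hball : ∀ k ∈ FunctionSpaces.Torus.freqBall (d := d) N₀, (∑ i, (c i : ℂ) * mFourier k (g i)) ≠ m)
    (y : Lp (EuclideanSpace ℝ d) 2 (volume : Measure (UnitAddTorus d)))
    (hsupp : ∀ k, mFourierCoeff (FunctionSpaces.EuclideanSpace.complexify ∘ (y : UnitAddTorus d → EuclideanSpace ℝ d)) k ≠ 0 →
      (∑ i, (c i : ℂ) * mFourier k (g i)) = m)
    {s t : ℝ} (hs : 0 ≤ s) (hst : s ≤ t) (htT : t ≤ T) :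
    ‖U s t y‖ ^ 2 ≤ Real.exp (-(8 * Real.pi ^ 2 * lo * (N₀ : ℝ) ^ 2 * (t - s))) * ‖y‖ ^ 2 := by
  set κ : ℝ := 8 * Real.pi ^ 2 * lo * (N₀ : ℝ) ^ 2 with hκ
  rcases hst.eq_or_lt with heq | hst'
  · subst heq
    rw [sub_self, mul_zero, neg_zero, Real.exp_zero, one_mul]
    exact pow_le_pow_left₀ (norm_nonneg _) (hU.norm_le s s y) 2
  have hsT : s < T := hst'.trans_le htT
  -- the Leray projection of the datum and its support
  set P := (divFreeL2 d).starProjection with hP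
  set φ : UnitAddTorus d → EuclideanSpace ℝ d := ((P y : Lp (EuclideanSpace ℝ d) 2 volume) : UnitAddTorus d → EuclideanSpace ℝ d)
    with hφdef
  have hφ : MemLp φ 2 volume := Lp.memLp (P y)
  have hφdiv : FunctionSpaces.Torus.IsWeaklyDivFree φ := isWeaklyDivFree_starProjection y
  have hsuppφ : ∀ k, mFourierCoeff (FunctionSpaces.EuclideanSpace.complexify ∘ φ) k ≠ 0 →
      (∑ i, (c i : ℂ) * mFourier k (g i)) = m := by
    intro k hk
    refine hsupp k fun h0 => hk ?_
    have hle := norm_mFourierCoeff_starProjection_le y k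
    rw [h0, norm_zero] at hle
    exact norm_le_zero_iff.1 hle
  -- the chosen window solution from `P y`, its support confinement and its decay
  set w := windowSol h𝔸 hlo hb hbdiv hs hsT hφ hφdiv with hwdef
  have hw := windowSol_spec h𝔸 hlo hb hbdiv hs hsT hφ hφdiv
  have hbs := memLp_top_stLift_shift_window (T := T) (b := b) hb hs
  have hoff : ∀ᵐ τ ∂(volume.restrict (Ioo 0 (T - s))), ∀ k ∈ FunctionSpaces.Torus.freqBall (d := d) N₀,
      mFourierCoeff (FunctionSpaces.EuclideanSpace.complexify ∘ w τ) k = 0 := by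
    have h1 := hw.ae_mFourierCoeff_eq_zero_of_multiplier' h𝔸 hlo hbs g c (fun i τ x => hper i (s + τ) x) hφ hm hsuppφ
    filter_upwards [h1] with τ hτ k hk using hτ k (hball k hk)
  have hdec := hw.ae_integral_norm_sq_le_exp_of_off_ball h𝔸 hlo hφ hφdiv hbs N₀ hoff
  have hrepr := hU.repr s hs hsT φ hφ hφdiv w hw
  have hPy : hφ.toLp φ = P y := Lp.toLp_coeFn (P y) hφ
  have hφE : ∫ x, ‖φ x‖ ^ 2 = ‖P y‖ ^ 2 := (norm_sq_eq_integral_norm_sq (P y)).symm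
  have hPle : ‖P y‖ ^ 2 ≤ ‖y‖ ^ 2 := pow_le_pow_left₀ (norm_nonneg _) ((divFreeL2 d).norm_starProjection_apply_le y) 2
  -- for a.e. window time: the decay of `U s (s+τ) y`
  have hae : ∀ᵐ τ ∂(volume.restrict (Ioo 0 (T - s))), ‖U s (s + τ) y‖ ^ 2 ≤ Real.exp (-(κ * τ)) * ‖y‖ ^ 2 := by
    filter_upwards [hdec, hrepr] with τ hτ hτr
    obtain ⟨hτm, hτe⟩ := hτr
    have e1 : U s (s + τ) y = hτm.toLp (w τ) := by
      rw [hτe, hPy, ← hU.apply_eq_apply_starProjection s (s + τ) y]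
    have e2 : ‖hτm.toLp (w τ)‖ ^ 2 = ∫ x, ‖w τ x‖ ^ 2 := by
      rw [norm_sq_eq_integral_norm_sq]
      exact integral_congr_ae (by filter_upwards [MemLp.coeFn_toLp hτm] with x hx; rw [hx])
    have hexp0 : 0 ≤ Real.exp (-(8 * Real.pi ^ 2 * lo * (N₀ : ℝ) ^ 2 * τ)) := (Real.exp_pos _).le
    calc ‖U s (s + τ) y‖ ^ 2 = ∫ x, ‖w τ x‖ ^ 2 := by rw [e1, e2]
      _ ≤ Real.exp (-(8 * Real.pi ^ 2 * lo * (N₀ : ℝ) ^ 2 * τ)) * ∫ x, ‖φ x‖ ^ 2 := hτ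
      _ ≤ Real.exp (-(κ * τ)) * ‖y‖ ^ 2 := by
          rw [hφE, hκ]
          exact mul_le_mul_of_nonneg_left (hPle) hexp0
  -- the endpoint `t`: monotonicity of the energy and density of the good window times below `t − s`
  by_contra hcon
  push Not at hcon
  have hcont : ContinuousAt (fun τ : ℝ => Real.exp (-(κ * τ)) * ‖y‖ ^ 2) (t - s) :=
    ((Real.continuous_exp.comp (continuous_const.mul continuous_id).neg).mul continuous_const).continuousAt
  have hev : ∀ᶠ τ in 𝓝 (t - s), Real.exp (-(κ * τ)) * ‖y‖ ^ 2 < ‖U s t y‖ ^ 2 := hcont.eventually (Iio_mem_nhds hcon)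
  obtain ⟨ε, hε, hεball⟩ := Metric.eventually_nhds_iff.1 hev
  set a : ℝ := max (t - s - ε / 2) ((t - s) / 2) with ha
  have hts : 0 < t - s := sub_pos.2 hst'
  have hab : a < t - s := max_lt (by linarith) (by linarith)
  have hsub : Ioo a (t - s) ⊆ Ioo 0 (T - s) := fun τ hτ =>
    ⟨lt_of_lt_of_le (by positivity : (0:ℝ) < (t - s) / 2) ((le_max_right _ _).trans hτ.1.le), hτ.2.trans_le (by linarith)⟩
  have hfalse : ∀ᵐ τ ∂(volume.restrict (Ioo a (t - s))), False := by
    filter_upwards [ae_restrict_of_ae_restrict_of_subset hsub hae, ae_restrict_mem measurableSet_Ioo] with τ hτ hτI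
    have h1 : ‖U s t y‖ ≤ ‖U s (s + τ) y‖ := hU.norm_apply_le_of_le hs (by linarith [hτI.1, (le_max_right _ _ : (t - s) / 2 ≤ a)])
      (by linarith [hτI.2]) htT y
    have h2 : dist τ (t - s) < ε := by
      rw [Real.dist_eq, abs_lt]
      constructor <;> linarith [hτI.1, hτI.2, (le_max_left _ _ : t - s - ε / 2 ≤ a)]
    have h3 := hεball h2
    have h4 : ‖U s t y‖ ^ 2 ≤ ‖U s (s + τ) y‖ ^ 2 := pow_le_pow_left₀ (norm_nonneg _) h1 2
    linarith
  have hne : NeBot (ae (volume.restrict (Ioo a (t - s)))) := by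
    rw [ae_neBot, Ne, Measure.restrict_eq_zero, Real.volume_Ioo]
    exact (ENNReal.ofReal_pos.2 (by linarith)).ne'
  obtain ⟨τ, hτ⟩ := hfalse.exists
  exact hτ

end IsPropagator

end Torus

end Literature.Analysis.FluidPDE

end
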